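import Literature.Analysis.ODE.LinearPeriodicAveraging
import HarnessLib

/-!
# First-order averaging for a FORCED linear dissipative system with a fast, large, mean-small perturbation
# (Sanders–Verhulst–Murdock, *Averaging Methods in Nonlinear Dynamical Systems*, Thm 2.8.1 / Lemma 2.8.2 (Besjes) /
# Thm 5.5.1, inhomogeneous linear case; Hale, *Ordinary Differential Equations*, Ch. V §3)

Topic `Literature/Analysis/ODE` (namespace `Literature.Analysis.ODE.PeriodicAveraging`).  Everything here is PROVED (no named fact, no
definition, no instance, no `sorry`).  Companion of `LinearPeriodicAveraging` (the homogeneous case `x' = -(Ḡ + g(t)) x`).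

THE SETTING. `E` a real Hilbert space, `Ḡ : E →L[ℝ] E` COERCIVE (`r_lo ‖v‖² ≤ ⟪Ḡ v, v⟫`), `g : ℝ → (E →L[ℝ] E)` continuous, large
pointwise (`‖g(s)‖ ≤ L`) with small window means (`‖∫_{nP}^{(n+1)P} g‖ ≤ η P`), a continuous FORCING `ρ` with `‖ρ(s)‖ ≤ ρ₀` on `[0,t]`, and
`x` continuous on `[0,t]` solving `x' = -(Ḡ + g(s)) x + ρ(s)` on the OPEN interval `(0,t)` (this is the regularity a weak solution's Fourier mode
has: continuous representative, derivative in the interior), with the a priori bound `‖x(s)‖ ≤ M` on `[0,t]`.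

THE ESTIMATE (`norm_sub_exp_apply_le_forced`).
`‖x(t) - exp(-tḠ) x(0)‖ ≤ M·(η (min(t,1/r_lo) + P) + L P (1 + (2‖Ḡ‖ + L)/r_lo)) + ρ₀·(min(t, 1/r_lo) + L P / r_lo)`.
The `M`-part is the homogeneous estimate VERBATIM; the forcing enters LINEARLY and only through the true solution `x` (no propagator of the
homogeneous non-autonomous equation is needed — the point of the "relative to an a priori bound" formulation: in the application the a priori
bound comes from a PDE energy inequality that a fictitious homogeneous solution would not enjoy).

THE PROOF is the printed one with the forcing carried along: Duhamel
`x(t) - exp(-tḠ)x(0) = -∫₀ᵗ exp(-(t-s)Ḡ) g(s) x(s) ds + ∫₀ᵗ exp(-(t-s)Ḡ) ρ(s) ds` (`sub_exp_apply_eq_forced`); on each window `[a,b]`, Besjes'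
integration by parts against `G_a(s) = ∫ₐˢ g` (`integral_window_eq_forced`) now produces the extra bulk term `∫ₐᵇ exp(-(t-s)Ḡ) G_a(s) ρ(s) ds`,
of size `L P ρ₀ ∫ₐᵇ e^{-r_lo(t-s)}`; the windows are summed exactly as in the homogeneous file (`norm_sub_exp_apply_le` there), and the pure forcing
integral is `≤ ρ₀ ∫₀ᵗ e^{-r_lo(t-s)} ds ≤ ρ₀ min(t, 1/r_lo)`.

## Mathlib / tree search
Tree: `LinearPeriodicAveraging.norm_sub_exp_apply_le` (homogeneous; requires `HasDerivAt` on the CLOSED interval), `norm_exp_neg_smul_apply_le`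
(contraction of `exp(-τḠ)`, reused).  Mathlib: `intervalIntegral.integral_eq_sub_of_hasDerivAt_of_le` (FTC with continuity on `[a,b]` and the
derivative on `(a,b)` only — this is what lets the solution be differentiable only in the interior), `sum_integral_adjacent_intervals`,
`norm_integral_le_of_norm_le`.

## References
* J. A. Sanders, F. Verhulst, J. Murdock, *Averaging Methods in Nonlinear Dynamical Systems*, 2nd ed., Applied Mathematical Sciences 59,
  Springer (2007): Theorem 2.8.1, Lemma 2.8.2 (Besjes), Theorem 5.5.1 — proofs carry over verbatim to the inhomogeneous linear system
  (held: `book:sandersnd-averaging-methods-nonlinear-dynamical-systems`, PDF pp. 68–69, 127–128). [`SandersVerhulstMurdock2007`]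
* J. K. Hale, *Ordinary Differential Equations*, 2nd ed., Krieger (1980), Ch. V §3, Lemma 3.2, eq. (3.8)–(3.9) and Ch. III §1 eq. (1.9)
  (variation of constants for the inhomogeneous linear system) (held: `book:halend-ordinary-differential-equations`). [`Hale1980`]
-/

noncomputable section

open NormedSpace Set MeasureTheory intervalIntegral
open scoped InnerProductSpace

namespace Literature.Analysis.ODE.PeriodicAveraging

variable {E : Type*} [NormedAddCommGroup E] [InnerProductSpace ℝ E] [CompleteSpace E]

/-! ## §1 Derivative and continuity of `s ↦ exp(-(t-s)Ḡ)` (file-local copies) -/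

/-- `d/ds exp(-(t-s)Ḡ) = exp(-(t-s)Ḡ) Ḡ`. [folklore] -/
private theorem hasDerivAt_exp_neg_sub_smul' (G : E →L[ℝ] E) (t s : ℝ) :
    HasDerivAt (fun u : ℝ => exp (-((t - u) • G))) (exp (-((t - s) • G)) * G) s := by
  have h0 : HasDerivAt (fun u : ℝ => exp (-(u • G))) (-(exp (-((t - s) • G)) * G)) (t - s) := by
    have h := hasDerivAt_exp_smul_const (-G) (t - s)
    simp only [smul_neg, mul_neg] at h
    exact h
  have h := h0.scomp s ((hasDerivAt_id s).const_sub t)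
  simpa [Function.comp_def] using h

/-- Continuity of `s ↦ exp(-(t-s)Ḡ)`. [folklore] -/
private theorem continuous_exp_neg_sub_smul' (G : E →L[ℝ] E) (t : ℝ) :
    Continuous fun s : ℝ => exp (-((t - s) • G)) :=
  continuous_iff_continuousAt.2 fun s => (hasDerivAt_exp_neg_sub_smul' G t s).continuousAt

/-! ## §2 Duhamel's formula with forcing -/

/-- **Duhamel with forcing**: if `x` is continuous on `[0,t]` and `x' = -(Ḡ x + g(s) x) + ρ(s)` on `(0,t)` (`g`, `ρ` continuous), then
`x(t) - exp(-tḠ) x(0) = -∫₀ᵗ exp(-(t-s)Ḡ) (g(s) x(s)) ds + ∫₀ᵗ exp(-(t-s)Ḡ) ρ(s) ds`.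
[cite: Hale1980, Ch. III §1 eq. (1.9) (variation of constants)] [cite: SandersVerhulstMurdock2007, proof of Theorem 2.8.1] -/
theorem sub_exp_apply_eq_forced (G : E →L[ℝ] E) {g : ℝ → E →L[ℝ] E} (hg : Continuous g) {ρ : ℝ → E}
    (x : ℝ → E) {t : ℝ} (ht : 0 ≤ t) (hxc : ContinuousOn x (Icc 0 t)) (hρc : ContinuousOn ρ (Icc 0 t))
    (hx : ∀ s ∈ Ioo 0 t, HasDerivAt x (-(G (x s) + g s (x s)) + ρ s) s) :
    x t - exp (-(t • G)) (x 0) =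
      -(∫ s in (0 : ℝ)..t, exp (-((t - s) • G)) (g s (x s))) + ∫ s in (0 : ℝ)..t, exp (-((t - s) • G)) (ρ s) := by
  set F : ℝ → E := fun s => exp (-((t - s) • G)) (x s) with hF
  have hFd : ∀ s ∈ Ioo 0 t, HasDerivAt F (-(exp (-((t - s) • G)) (g s (x s))) + exp (-((t - s) • G)) (ρ s)) s := by
    intro s hs
    have h := (hasDerivAt_exp_neg_sub_smul' G t s).clm_apply (hx s hs)
    have h0 : (exp (-((t - s) • G)) * G) (x s) + (exp (-((t - s) • G))) (-(G (x s) + g s (x s)) + ρ s) =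
        -(exp (-((t - s) • G)) (g s (x s))) + exp (-((t - s) • G)) (ρ s) := by
      simp only [mul_apply_eq_comp, map_neg, map_add]; abel
    rw [h0] at h
    exact h
  have hEc := continuous_exp_neg_sub_smul' G t
  have hcont : ContinuousOn F (Icc 0 t) := hEc.continuousOn.clm_apply hxc
  have h1c : ContinuousOn (fun s => -(exp (-((t - s) • G)) (g s (x s)))) (Icc 0 t) :=
    (hEc.continuousOn.clm_apply (hg.continuousOn.clm_apply hxc)).neg
  have h2c : ContinuousOn (fun s => exp (-((t - s) • G)) (ρ s)) (Icc 0 t) := hEc.continuousOn.clm_apply hρc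
  have hint := integral_eq_sub_of_hasDerivAt_of_le ht hcont hFd ((h1c.add h2c).intervalIntegrable_of_Icc ht)
  rw [intervalIntegral.integral_add (h1c.intervalIntegrable_of_Icc ht) (h2c.intervalIntegrable_of_Icc ht),
    intervalIntegral.integral_neg] at hint
  have hFt : F t = x t := by simp [hF, exp_zero]
  have hF0 : F 0 = exp (-(t • G)) (x 0) := by simp [hF]
  rw [← hFt, ← hF0, ← hint]

/-! ## §3 One window with forcing: Besjes' integration by parts -/

/-- **One window, exact identity, with forcing.** For `0 ≤ a ≤ b ≤ t` and `G_a(s) = ∫ₐˢ g`: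
`∫ₐᵇ exp(-(t-s)Ḡ) g(s) x(s) ds = exp(-(t-b)Ḡ) G_a(b) x(b) - ∫ₐᵇ exp(-(t-s)Ḡ) [Ḡ G_a(s) x(s) - G_a(s) (Ḡ x(s) + g(s) x(s)) + G_a(s) ρ(s)] ds`.
[cite: SandersVerhulstMurdock2007, Lemma 2.8.2 (Besjes), proof] -/
theorem integral_window_eq_forced (G : E →L[ℝ] E) {g : ℝ → E →L[ℝ] E} (hg : Continuous g) {ρ : ℝ → E}
    (x : ℝ → E) {a b t : ℝ} (ha : 0 ≤ a) (hab : a ≤ b) (hbt : b ≤ t) (hxc : ContinuousOn x (Icc 0 t)) (hρc : ContinuousOn ρ (Icc 0 t))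
    (hx : ∀ s ∈ Ioo 0 t, HasDerivAt x (-(G (x s) + g s (x s)) + ρ s) s) :
    ∫ s in a..b, exp (-((t - s) • G)) (g s (x s)) =
      exp (-((t - b) • G)) ((∫ σ in a..b, g σ) (x b)) -
      ∫ s in a..b, exp (-((t - s) • G))
        (G ((∫ σ in a..s, g σ) (x s)) - (∫ σ in a..s, g σ) (G (x s) + g s (x s)) + (∫ σ in a..s, g σ) (ρ s)) := by
  set Ga : ℝ → E →L[ℝ] E := fun s => ∫ σ in a..s, g σ with hGa
  have hGad : ∀ s, HasDerivAt Ga (g s) s := fun s => (hg.integral_hasStrictDerivAt a s).hasDerivAt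
  set H : ℝ → E := fun s => exp (-((t - s) • G)) (Ga s (x s)) with hH
  have hsubI : Icc a b ⊆ Icc 0 t := Icc_subset_Icc ha hbt
  have hsubO : Ioo a b ⊆ Ioo 0 t := Ioo_subset_Ioo ha hbt
  -- H' = exp(-(t-s)Ḡ) [g x + (Ḡ Ga x - Ga (Ḡ x + g x) + Ga ρ)]
  have hHd : ∀ s ∈ Ioo a b, HasDerivAt H (exp (-((t - s) • G)) (g s (x s)) +
      exp (-((t - s) • G)) (G (Ga s (x s)) - Ga s (G (x s) + g s (x s)) + Ga s (ρ s))) s := by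
    intro s hs
    have h1 : HasDerivAt (fun u => Ga u (x u)) (g s (x s) + Ga s (-(G (x s) + g s (x s)) + ρ s)) s :=
      (hGad s).clm_apply (hx s (hsubO hs))
    have h := (hasDerivAt_exp_neg_sub_smul' G t s).clm_apply h1
    have h0 : (exp (-((t - s) • G)) * G) (Ga s (x s)) +
        exp (-((t - s) • G)) (g s (x s) + Ga s (-(G (x s) + g s (x s)) + ρ s)) =
        exp (-((t - s) • G)) (g s (x s)) +
          exp (-((t - s) • G)) (G (Ga s (x s)) - Ga s (G (x s) + g s (x s)) + Ga s (ρ s)) := by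
      simp only [mul_apply_eq_comp, map_neg, map_add, map_sub]; abel
    rw [h0] at h
    exact h
  have hxc' : ContinuousOn x (Icc a b) := hxc.mono hsubI
  have hρc' : ContinuousOn ρ (Icc a b) := hρc.mono hsubI
  have hEc := continuous_exp_neg_sub_smul' G t
  have hGac : Continuous Ga := continuous_iff_continuousAt.2 fun s => (hGad s).continuousAt
  have hHc : ContinuousOn H (Icc a b) := hEc.continuousOn.clm_apply (hGac.continuousOn.clm_apply hxc')
  have h1c : ContinuousOn (fun s => exp (-((t - s) • G)) (g s (x s))) (Icc a b) :=
    hEc.continuousOn.clm_apply (hg.continuousOn.clm_apply hxc')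
  have h2c : ContinuousOn (fun s => exp (-((t - s) • G))
      (G (Ga s (x s)) - Ga s (G (x s) + g s (x s)) + Ga s (ρ s))) (Icc a b) :=
    hEc.continuousOn.clm_apply (((continuous_const.continuousOn.clm_apply
      (hGac.continuousOn.clm_apply hxc')).sub (hGac.continuousOn.clm_apply
        ((continuous_const.continuousOn.clm_apply hxc').add (hg.continuousOn.clm_apply hxc')))).add
      (hGac.continuousOn.clm_apply hρc'))
  have hint := integral_eq_sub_of_hasDerivAt_of_le hab hHc hHd ((h1c.add h2c).intervalIntegrable_of_Icc hab)
  rw [intervalIntegral.integral_add (h1c.intervalIntegrable_of_Icc hab) (h2c.intervalIntegrable_of_Icc hab)] at hint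
  have hHa : H a = 0 := by simp [hH, hGa]
  have hHb : H b = exp (-((t - b) • G)) ((∫ σ in a..b, g σ) (x b)) := rfl
  rw [hHa, sub_zero, hHb] at hint
  rw [← hint]; abel

/-- **One window, bound, with forcing.**  With the contraction rate `r_lo` of `Ḡ`, `‖Ḡ‖ ≤ Gn`, `‖g‖ ≤ L`, `‖x‖ ≤ M`, `‖ρ‖ ≤ ρ₀` on `[0, t]`, a
window `[a, b] ⊆ [0, t]` of length `b - a ≤ P` and `‖∫ₐᵇ g‖ ≤ μ` contributes
`‖∫ₐᵇ exp(-(t-s)Ḡ) g x‖ ≤ e^{-r_lo (t-b)} μ M + L P ((2 Gn + L) M + ρ₀) ∫ₐᵇ e^{-r_lo (t-s)} ds`.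
[cite: SandersVerhulstMurdock2007, Lemma 2.8.2 (Besjes) and proof of Theorem 5.5.1] -/
theorem norm_integral_window_le_forced (G : E →L[ℝ] E) {g : ℝ → E →L[ℝ] E} (hg : Continuous g) {ρ : ℝ → E}
    (x : ℝ → E) {rlo Gn L M ρ₀ P μ a b t : ℝ} (ha : 0 ≤ a) (hab : a ≤ b) (hbt : b ≤ t)
    (hbaP : b - a ≤ P)
    (hcoer : ∀ v : E, rlo * ‖v‖ ^ 2 ≤ ⟪G v, v⟫_ℝ) (hGn : ‖G‖ ≤ Gn)
    (hL : ∀ s ∈ Icc 0 t, ‖g s‖ ≤ L) (hμ : ‖∫ σ in a..b, g σ‖ ≤ μ)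
    (hxc : ContinuousOn x (Icc 0 t)) (hρc : ContinuousOn ρ (Icc 0 t))
    (hx : ∀ s ∈ Ioo 0 t, HasDerivAt x (-(G (x s) + g s (x s)) + ρ s) s)
    (hM : ∀ s ∈ Icc 0 t, ‖x s‖ ≤ M) (hρ : ∀ s ∈ Icc 0 t, ‖ρ s‖ ≤ ρ₀) :
    ‖∫ s in a..b, exp (-((t - s) • G)) (g s (x s))‖ ≤
      Real.exp (-(rlo * (t - b))) * μ * M +
        L * P * ((2 * Gn + L) * M + ρ₀) * ∫ s in a..b, Real.exp (-(rlo * (t - s))) := by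
  have hbI : b ∈ Icc 0 t := ⟨ha.trans hab, hbt⟩
  have hM0 : 0 ≤ M := (norm_nonneg _).trans (hM b hbI)
  have hL0 : 0 ≤ L := (norm_nonneg _).trans (hL b hbI)
  have hGn0 : 0 ≤ Gn := (norm_nonneg _).trans hGn
  have hρ00 : 0 ≤ ρ₀ := (norm_nonneg _).trans (hρ b hbI)
  have hP0 : 0 ≤ P := (sub_nonneg.2 hab).trans hbaP
  rw [integral_window_eq_forced G hg x ha hab hbt hxc hρc hx]
  -- antiderivative bound ‖∫ₐˢ g‖ ≤ L P on [a, b]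
  have hGa : ∀ s ∈ Icc a b, ‖∫ σ in a..s, g σ‖ ≤ L * P := by
    intro s hs
    have h1 : ‖∫ σ in a..s, g σ‖ ≤ L * |s - a| := by
      refine norm_integral_le_of_norm_le_const fun σ hσ => hL σ ?_
      rw [uIoc_of_le hs.1] at hσ
      exact ⟨ha.trans hσ.1.le, (hσ.2.trans hs.2).trans hbt⟩
    rw [abs_of_nonneg (sub_nonneg.2 hs.1)] at h1
    exact h1.trans (mul_le_mul_of_nonneg_left ((sub_le_sub_right hs.2 a).trans hbaP) hL0)
  -- boundary term
  have hbd : ‖exp (-((t - b) • G)) ((∫ σ in a..b, g σ) (x b))‖ ≤ Real.exp (-(rlo * (t - b))) * μ * M := by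
    refine (norm_exp_neg_smul_apply_le G hcoer _ (sub_nonneg.2 hbt)).trans ?_
    rw [mul_assoc]
    refine mul_le_mul_of_nonneg_left ?_ (Real.exp_pos _).le
    exact (ContinuousLinearMap.le_opNorm _ _).trans (mul_le_mul hμ (hM b hbI) (norm_nonneg _)
      ((norm_nonneg _).trans hμ))
  -- bulk term
  have hbulk : ‖∫ s in a..b, exp (-((t - s) • G))
      (G ((∫ σ in a..s, g σ) (x s)) - (∫ σ in a..s, g σ) (G (x s) + g s (x s)) + (∫ σ in a..s, g σ) (ρ s))‖ ≤
      ∫ s in a..b, L * P * ((2 * Gn + L) * M + ρ₀) * Real.exp (-(rlo * (t - s))) := by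
    refine norm_integral_le_of_norm_le hab (Filter.Eventually.of_forall fun s hs => ?_) ?_
    · have hs' : s ∈ Icc a b := ⟨hs.1.le, hs.2⟩
      have hsI : s ∈ Icc 0 t := ⟨ha.trans hs.1.le, hs.2.trans hbt⟩
      refine (norm_exp_neg_smul_apply_le G hcoer _ (sub_nonneg.2 hsI.2)).trans ?_
      have hGas := hGa s hs'
      have hxs := hM s hsI
      have hgs := hL s hsI
      have hρs := hρ s hsI
      have h1 : ‖G ((∫ σ in a..s, g σ) (x s))‖ ≤ Gn * (L * P * M) :=
        (G.le_opNorm _).trans (mul_le_mul hGn (((∫ σ in a..s, g σ).le_opNorm _).trans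
          (mul_le_mul hGas hxs (norm_nonneg _) (mul_nonneg hL0 hP0))) (norm_nonneg _) hGn0)
      have h2 : ‖(∫ σ in a..s, g σ) (G (x s) + g s (x s))‖ ≤ L * P * ((Gn + L) * M) := by
        refine ((∫ σ in a..s, g σ).le_opNorm _).trans (mul_le_mul hGas ?_ (norm_nonneg _)
          (mul_nonneg hL0 hP0))
        refine (norm_add_le _ _).trans ?_
        rw [add_mul]
        exact add_le_add ((G.le_opNorm _).trans (mul_le_mul hGn hxs (norm_nonneg _) hGn0))
          (((g s).le_opNorm _).trans (mul_le_mul hgs hxs (norm_nonneg _) hL0))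
      have h2' : ‖(∫ σ in a..s, g σ) (ρ s)‖ ≤ L * P * ρ₀ :=
        ((∫ σ in a..s, g σ).le_opNorm _).trans (mul_le_mul hGas hρs (norm_nonneg _) (mul_nonneg hL0 hP0))
      have h3 : ‖G ((∫ σ in a..s, g σ) (x s)) - (∫ σ in a..s, g σ) (G (x s) + g s (x s)) + (∫ σ in a..s, g σ) (ρ s)‖ ≤
          L * P * ((2 * Gn + L) * M + ρ₀) := by
        refine (norm_add_le _ _).trans ((add_le_add (norm_sub_le _ _) le_rfl).trans ?_)
        nlinarith [h1, h2, h2']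
      calc Real.exp (-(rlo * (t - s))) *
            ‖G ((∫ σ in a..s, g σ) (x s)) - (∫ σ in a..s, g σ) (G (x s) + g s (x s)) + (∫ σ in a..s, g σ) (ρ s)‖
          ≤ Real.exp (-(rlo * (t - s))) * (L * P * ((2 * Gn + L) * M + ρ₀)) :=
            mul_le_mul_of_nonneg_left h3 (Real.exp_pos _).le
        _ = L * P * ((2 * Gn + L) * M + ρ₀) * Real.exp (-(rlo * (t - s))) := by ring
    · exact (continuous_const.mul ((continuous_const.mul
        (continuous_const.sub continuous_id)).neg.rexp)).intervalIntegrable _ _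
  rw [intervalIntegral.integral_const_mul] at hbulk
  exact (norm_sub_le _ _).trans (add_le_add hbd hbulk)

/-! ## §4 Summation over the windows -/

/-- Geometric sum of the contraction factors at the window ends: for `N P ≤ t`, `Σ_{k<N} e^{-r_lo (t - (k+1)P)} ≤ 1 + 1/(r_lo P)`. [folklore] -/
private theorem sum_exp_neg_le' {rlo P t : ℝ} (hrlo : 0 < rlo) (hP : 0 < P) (N : ℕ) (hN : (N : ℝ) * P ≤ t) :
    ∑ k ∈ Finset.range N, Real.exp (-(rlo * (t - ((k : ℝ) + 1) * P))) ≤ 1 + 1 / (rlo * P) := by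
  set q : ℝ := Real.exp (-(rlo * P)) with hq
  have hq0 : 0 ≤ q := (Real.exp_pos _).le
  have hq1 : q < 1 := Real.exp_lt_one_iff.2 (by nlinarith)
  have hterm : ∀ k ∈ Finset.range N,
      Real.exp (-(rlo * (t - ((k : ℝ) + 1) * P))) ≤ q ^ (N - 1 - k) := by
    intro k hk
    rw [Finset.mem_range] at hk
    rw [hq, ← Real.exp_nat_mul, Real.exp_le_exp]
    have hcast : ((N - 1 - k : ℕ) : ℝ) = (N : ℝ) - 1 - k := by
      rw [Nat.cast_sub (by omega), Nat.cast_sub (by omega)]; simp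
    rw [hcast]
    nlinarith
  calc ∑ k ∈ Finset.range N, Real.exp (-(rlo * (t - ((k : ℝ) + 1) * P)))
      ≤ ∑ k ∈ Finset.range N, q ^ (N - 1 - k) := Finset.sum_le_sum hterm
    _ = ∑ k ∈ Finset.range N, q ^ k := Finset.sum_range_reflect (fun k => q ^ k) N
    _ ≤ ∑' k, q ^ k := (summable_geometric_of_lt_one hq0 hq1).sum_le_tsum _ (fun k _ => pow_nonneg hq0 k)
    _ = (1 - q)⁻¹ := tsum_geometric_of_lt_one hq0 hq1
    _ ≤ (1 - 1 / (1 + rlo * P))⁻¹ := by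
        have hq' : q ≤ 1 / (1 + rlo * P) := by
          rw [hq, Real.exp_neg, ← one_div]
          exact one_div_le_one_div_of_le (by positivity) (by linarith [Real.add_one_le_exp (rlo * P)])
        have hpos : 0 < 1 - 1 / (1 + rlo * P) := by
          rw [sub_pos, div_lt_one (by positivity)]; nlinarith
        exact inv_anti₀ hpos (sub_le_sub_left hq' 1)
    _ = 1 + 1 / (rlo * P) := by field_simp; ring

/-- `∫ₐᵇ e^{-r_lo (t - s)} ds = (e^{-r_lo (t-b)} - e^{-r_lo (t-a)}) / r_lo`. [folklore] -/
private theorem integral_exp_neg_sub' (rlo t a b : ℝ) (hrlo : rlo ≠ 0) :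
    ∫ s in a..b, Real.exp (-(rlo * (t - s))) =
      (Real.exp (-(rlo * (t - b))) - Real.exp (-(rlo * (t - a)))) / rlo := by
  have hd : ∀ s, HasDerivAt (fun u => Real.exp (-(rlo * (t - u))) / rlo) (Real.exp (-(rlo * (t - s)))) s := by
    intro s
    have h := ((((hasDerivAt_id s).const_sub t).const_mul rlo).neg.exp).div_const rlo
    field_simp at h
    simpa using h
  rw [integral_eq_sub_of_hasDerivAt (fun s _ => hd s)
    ((continuous_const.mul (continuous_const.sub continuous_id)).neg.rexp.intervalIntegrable _ _)]
  ring

/-- `∫₀ᵗ e^{-r_lo (t - s)} ds ≤ min t (1/r_lo)` (`r_lo > 0`, `t ≥ 0`). [folklore] -/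
private theorem integral_exp_neg_sub_le_min {rlo t : ℝ} (hrlo : 0 < rlo) (ht : 0 ≤ t) :
    ∫ s in (0:ℝ)..t, Real.exp (-(rlo * (t - s))) ≤ min t (1 / rlo) := by
  refine le_min ?_ ?_
  · have h : ∫ s in (0:ℝ)..t, Real.exp (-(rlo * (t - s))) ≤ ∫ _ in (0:ℝ)..t, (1:ℝ) := by
      refine intervalIntegral.integral_mono_on ht
        ((continuous_const.mul (continuous_const.sub continuous_id)).neg.rexp.intervalIntegrable _ _)
        intervalIntegrable_const fun s hs => ?_
      rw [Real.exp_le_one_iff]; nlinarith [hs.2]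
    simpa using h
  · rw [integral_exp_neg_sub' rlo t 0 t hrlo.ne']
    refine div_le_div_of_nonneg_right ?_ hrlo.le
    simp only [sub_self, mul_zero, neg_zero, Real.exp_zero, sub_zero]
    linarith [Real.exp_pos (-(rlo * t))]

/-- **THE FORCED AVERAGING ESTIMATE (relative to an a priori bound).** Let `Ḡ` be coercive with rate `r_lo > 0` and `‖Ḡ‖ ≤ Gn`; `g` continuous
with `‖g(s)‖ ≤ L` on `[0, t]` and window means `‖∫_{nP}^{(n+1)P} g‖ ≤ η P` for every full window inside `[0, t]` (`P > 0`, `η ≥ 0`); `ρ` continuous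
on `[0,t]` with `‖ρ(s)‖ ≤ ρ₀`; `x` continuous on `[0,t]`, solving `x' = -(Ḡ x + g x) + ρ` on `(0,t)`, with `‖x(s)‖ ≤ M` on `[0,t]`. Then
`‖x(t) - exp(-tḠ) x(0)‖ ≤ M (η (min(t, 1/r_lo) + P) + L P (1 + (2 Gn + L)/r_lo)) + ρ₀ (min(t, 1/r_lo) + L P / r_lo)`.
[cite: SandersVerhulstMurdock2007, Theorem 2.8.1 and Theorem 5.5.1 (Eckhaus/Sanchez-Palencia), inhomogeneous linear case]
[cite: Hale1980, Ch. V §3 Lemma 3.2] -/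
theorem norm_sub_exp_apply_le_forced (G : E →L[ℝ] E) {g : ℝ → E →L[ℝ] E} (hg : Continuous g) {ρ : ℝ → E}
    (x : ℝ → E) {rlo Gn L η P M ρ₀ t : ℝ} (hrlo : 0 < rlo) (hP : 0 < P) (hη : 0 ≤ η) (ht : 0 ≤ t)
    (hcoer : ∀ v : E, rlo * ‖v‖ ^ 2 ≤ ⟪G v, v⟫_ℝ) (hGn : ‖G‖ ≤ Gn)
    (hL : ∀ s ∈ Icc 0 t, ‖g s‖ ≤ L)
    (hmean : ∀ n : ℕ, ((n : ℝ) + 1) * P ≤ t →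
      ‖∫ s in ((n : ℝ) * P)..(((n : ℝ) + 1) * P), g s‖ ≤ η * P)
    (hxc : ContinuousOn x (Icc 0 t)) (hρc : ContinuousOn ρ (Icc 0 t))
    (hx : ∀ s ∈ Ioo 0 t, HasDerivAt x (-(G (x s) + g s (x s)) + ρ s) s)
    (hM : ∀ s ∈ Icc 0 t, ‖x s‖ ≤ M) (hρ : ∀ s ∈ Icc 0 t, ‖ρ s‖ ≤ ρ₀) :
    ‖x t - exp (-(t • G)) (x 0)‖ ≤
      M * (η * (min t (1 / rlo) + P) + L * P * (1 + (2 * Gn + L) / rlo)) + ρ₀ * (min t (1 / rlo) + L * P / rlo) := by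
  have h0I : (0 : ℝ) ∈ Icc 0 t := ⟨le_rfl, ht⟩
  have hM0 : 0 ≤ M := (norm_nonneg _).trans (hM 0 h0I)
  have hL0 : 0 ≤ L := (norm_nonneg _).trans (hL 0 h0I)
  have hGn0 : 0 ≤ Gn := (norm_nonneg _).trans hGn
  have hρ00 : 0 ≤ ρ₀ := (norm_nonneg _).trans (hρ 0 h0I)
  set K : ℝ := L * P * ((2 * Gn + L) * M + ρ₀) with hK
  have hK0 : 0 ≤ K := by positivity
  -- the windows
  set N : ℕ := ⌊t / P⌋₊ with hN
  have hNP : (N : ℝ) * P ≤ t := by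
    have := Nat.floor_le (div_nonneg ht hP.le); rw [← hN] at this
    exact (le_div_iff₀ hP).1 this
  have htNP : t - N * P ≤ P := by
    have := Nat.lt_floor_add_one (t / P); rw [← hN] at this
    have := (div_lt_iff₀ hP).1 this
    linarith
  -- the integrands
  set f : ℝ → E := fun s => exp (-((t - s) • G)) (g s (x s)) with hf
  have hfc : ContinuousOn f (Icc 0 t) :=
    (continuous_exp_neg_sub_smul' G t).continuousOn.clm_apply (hg.continuousOn.clm_apply hxc)
  have hfi : ∀ a b, 0 ≤ a → a ≤ b → b ≤ t → IntervalIntegrable f volume a b := fun a b ha hab hbt =>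
    (hfc.mono (Icc_subset_Icc ha hbt)).intervalIntegrable_of_Icc hab
  -- the forcing integral
  have hforce : ‖∫ s in (0 : ℝ)..t, exp (-((t - s) • G)) (ρ s)‖ ≤ ρ₀ * min t (1 / rlo) := by
    have h1 : ‖∫ s in (0 : ℝ)..t, exp (-((t - s) • G)) (ρ s)‖ ≤ ∫ s in (0:ℝ)..t, ρ₀ * Real.exp (-(rlo * (t - s))) := by
      refine norm_integral_le_of_norm_le ht (Filter.Eventually.of_forall fun s hs => ?_) ?_
      · have hsI : s ∈ Icc 0 t := ⟨hs.1.le, hs.2⟩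
        calc ‖exp (-((t - s) • G)) (ρ s)‖ ≤ Real.exp (-(rlo * (t - s))) * ‖ρ s‖ :=
              norm_exp_neg_smul_apply_le G hcoer _ (sub_nonneg.2 hsI.2)
          _ ≤ Real.exp (-(rlo * (t - s))) * ρ₀ := mul_le_mul_of_nonneg_left (hρ s hsI) (Real.exp_pos _).le
          _ = ρ₀ * Real.exp (-(rlo * (t - s))) := mul_comm _ _
      · exact (continuous_const.mul ((continuous_const.mul
          (continuous_const.sub continuous_id)).neg.rexp)).intervalIntegrable _ _
    rw [intervalIntegral.integral_const_mul] at h1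
    exact h1.trans (mul_le_mul_of_nonneg_left (integral_exp_neg_sub_le_min hrlo ht) hρ00)
  -- Duhamel and the decomposition ∫₀ᵗ = Σ_{k<N} ∫_{kP}^{(k+1)P} + ∫_{NP}^t
  rw [sub_exp_apply_eq_forced G hg x ht hxc hρc hx]
  have hsplit : ∫ s in (0 : ℝ)..t, f s =
      (∑ k ∈ Finset.range N, ∫ s in ((k : ℝ) * P)..(((k : ℝ) + 1) * P), f s) +
        ∫ s in ((N : ℝ) * P)..t, f s := by
    have hadj := sum_integral_adjacent_intervals (μ := volume) (f := f) (a := fun k : ℕ => (k : ℝ) * P)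
      (n := N) (fun k hk => hfi _ _ (by positivity) (by push_cast; nlinarith)
        (le_trans (by push_cast; nlinarith [show ((k : ℝ) + 1) ≤ N by exact_mod_cast hk]) hNP))
    simp only [Nat.cast_zero, zero_mul] at hadj
    push_cast at hadj ⊢
    rw [hadj]
    exact (integral_add_adjacent_intervals (hfi _ _ le_rfl (by positivity) hNP)
      (hfi _ _ (by positivity) hNP le_rfl)).symm
  have hmainI : ‖∫ s in (0 : ℝ)..t, f s‖ ≤ M * (η * (min t (1 / rlo) + P) + L * P * (1 + (2 * Gn + L) / rlo)) + ρ₀ * (L * P / rlo) := by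
    rw [hsplit]
    -- window bounds
    have hwin : ∀ k ∈ Finset.range N, ‖∫ s in ((k : ℝ) * P)..(((k : ℝ) + 1) * P), f s‖ ≤
        Real.exp (-(rlo * (t - ((k : ℝ) + 1) * P))) * (η * P) * M +
          K * ∫ s in ((k : ℝ) * P)..(((k : ℝ) + 1) * P), Real.exp (-(rlo * (t - s))) := by
      intro k hk
      rw [Finset.mem_range] at hk
      have hk1 : ((k : ℝ) + 1) * P ≤ t :=
        le_trans (by nlinarith [show ((k : ℝ) + 1) ≤ N by exact_mod_cast hk]) hNP
      exact norm_integral_window_le_forced G hg x (by positivity) (by nlinarith) hk1 (by ring_nf; rfl)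
        hcoer hGn hL (hmean k hk1) hxc hρc hx hM hρ
    have hlast : ‖∫ s in ((N : ℝ) * P)..t, f s‖ ≤
        Real.exp (-(rlo * (t - t))) * (L * P) * M +
          K * ∫ s in ((N : ℝ) * P)..t, Real.exp (-(rlo * (t - s))) := by
      refine norm_integral_window_le_forced G hg x (by positivity) hNP le_rfl htNP hcoer hGn hL ?_ hxc hρc hx hM hρ
      have h1 : ‖∫ σ in ((N : ℝ) * P)..t, g σ‖ ≤ L * |t - N * P| :=
        norm_integral_le_of_norm_le_const fun σ hσ => hL σ (by
          rw [uIoc_of_le hNP] at hσ; exact ⟨le_trans (by positivity) hσ.1.le, hσ.2⟩)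
      rw [abs_of_nonneg (sub_nonneg.2 hNP)] at h1
      exact h1.trans (mul_le_mul_of_nonneg_left htNP hL0)
    -- sum of the exponential integrals = ∫₀ᵗ ≤ 1/rlo
    have hei : ∀ a b : ℝ, IntervalIntegrable (fun s => Real.exp (-(rlo * (t - s)))) volume a b :=
      fun a b => (continuous_const.mul (continuous_const.sub continuous_id)).neg.rexp.intervalIntegrable _ _
    have hesum : (∑ k ∈ Finset.range N, ∫ s in ((k : ℝ) * P)..(((k : ℝ) + 1) * P),
        Real.exp (-(rlo * (t - s)))) + ∫ s in ((N : ℝ) * P)..t, Real.exp (-(rlo * (t - s))) =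
        ∫ s in (0 : ℝ)..t, Real.exp (-(rlo * (t - s))) := by
      have hadj := sum_integral_adjacent_intervals (μ := volume)
        (f := fun s => Real.exp (-(rlo * (t - s)))) (a := fun k : ℕ => (k : ℝ) * P) (n := N)
        (fun k _ => hei _ _)
      simp only [Nat.cast_zero, zero_mul] at hadj
      push_cast at hadj ⊢
      rw [hadj]
      exact integral_add_adjacent_intervals (hei _ _) (hei _ _)
    have heint : ∫ s in (0 : ℝ)..t, Real.exp (-(rlo * (t - s))) ≤ 1 / rlo :=
      (integral_exp_neg_sub_le_min hrlo ht).trans (min_le_right _ _)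
    -- the geometric sum of boundary factors
    have hS1 := sum_exp_neg_le' hrlo hP N hNP
    have hSmin : (∑ k ∈ Finset.range N, Real.exp (-(rlo * (t - ((k : ℝ) + 1) * P)))) * (η * P) * M ≤
        M * (η * (min t (1 / rlo) + P)) := by
      have h1 : P * (∑ k ∈ Finset.range N, Real.exp (-(rlo * (t - ((k : ℝ) + 1) * P)))) ≤
          P + 1 / rlo := by
        calc P * (∑ k ∈ Finset.range N, Real.exp (-(rlo * (t - ((k : ℝ) + 1) * P))))
            ≤ P * (1 + 1 / (rlo * P)) := mul_le_mul_of_nonneg_left hS1 hP.le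
          _ = P + 1 / rlo := by field_simp
      have hterm : ∀ k ∈ Finset.range N, Real.exp (-(rlo * (t - ((k : ℝ) + 1) * P))) ≤ 1 := by
        intro k hk
        rw [Finset.mem_range] at hk
        rw [Real.exp_le_one_iff]
        have hk1 : ((k : ℝ) + 1) * P ≤ t := by
          have : ((k : ℝ) + 1) ≤ N := by exact_mod_cast hk
          nlinarith
        nlinarith
      have hS2 : ∑ k ∈ Finset.range N, Real.exp (-(rlo * (t - ((k : ℝ) + 1) * P))) ≤ N := by
        calc ∑ k ∈ Finset.range N, Real.exp (-(rlo * (t - ((k : ℝ) + 1) * P)))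
            ≤ ∑ _k ∈ Finset.range N, (1 : ℝ) := Finset.sum_le_sum hterm
          _ = N := by simp
      have h2 : P * (∑ k ∈ Finset.range N, Real.exp (-(rlo * (t - ((k : ℝ) + 1) * P)))) ≤ t := by
        nlinarith
      have h3 : P * (∑ k ∈ Finset.range N, Real.exp (-(rlo * (t - ((k : ℝ) + 1) * P)))) ≤
          min t (1 / rlo) + P := by
        rcases le_total t (1 / rlo) with h | h
        · rw [min_eq_left h]; linarith
        · rw [min_eq_right h]; linarith
      calc (∑ k ∈ Finset.range N, Real.exp (-(rlo * (t - ((k : ℝ) + 1) * P)))) * (η * P) * M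
          = (η * M) * (P * ∑ k ∈ Finset.range N, Real.exp (-(rlo * (t - ((k : ℝ) + 1) * P)))) := by
            ring
        _ ≤ (η * M) * (min t (1 / rlo) + P) := mul_le_mul_of_nonneg_left h3 (mul_nonneg hη hM0)
        _ = M * (η * (min t (1 / rlo) + P)) := by ring
    have hA : (∑ k ∈ Finset.range N, (Real.exp (-(rlo * (t - ((k : ℝ) + 1) * P))) * (η * P) * M +
        K * ∫ s in ((k : ℝ) * P)..(((k : ℝ) + 1) * P), Real.exp (-(rlo * (t - s))))) =
        (∑ k ∈ Finset.range N, Real.exp (-(rlo * (t - ((k : ℝ) + 1) * P)))) * (η * P) * M +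
          K * ∑ k ∈ Finset.range N, ∫ s in ((k : ℝ) * P)..(((k : ℝ) + 1) * P),
            Real.exp (-(rlo * (t - s))) := by
      rw [Finset.sum_add_distrib, Finset.sum_mul, Finset.sum_mul, Finset.mul_sum]
    calc ‖(∑ k ∈ Finset.range N, ∫ s in ((k : ℝ) * P)..(((k : ℝ) + 1) * P), f s) +
            ∫ s in ((N : ℝ) * P)..t, f s‖
        ≤ (∑ k ∈ Finset.range N, ‖∫ s in ((k : ℝ) * P)..(((k : ℝ) + 1) * P), f s‖) +
            ‖∫ s in ((N : ℝ) * P)..t, f s‖ := (norm_add_le _ _).trans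
              (add_le_add (norm_sum_le _ _) le_rfl)
      _ ≤ (∑ k ∈ Finset.range N, (Real.exp (-(rlo * (t - ((k : ℝ) + 1) * P))) * (η * P) * M +
            K * ∫ s in ((k : ℝ) * P)..(((k : ℝ) + 1) * P), Real.exp (-(rlo * (t - s))))) +
            (Real.exp (-(rlo * (t - t))) * (L * P) * M +
              K * ∫ s in ((N : ℝ) * P)..t, Real.exp (-(rlo * (t - s)))) :=
          add_le_add (Finset.sum_le_sum hwin) hlast
      _ = (∑ k ∈ Finset.range N, Real.exp (-(rlo * (t - ((k : ℝ) + 1) * P)))) * (η * P) * M +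
            L * P * M + K * ((∑ k ∈ Finset.range N,
            ∫ s in ((k : ℝ) * P)..(((k : ℝ) + 1) * P), Real.exp (-(rlo * (t - s)))) +
              ∫ s in ((N : ℝ) * P)..t, Real.exp (-(rlo * (t - s)))) := by
          rw [hA]
          simp only [sub_self, mul_zero, neg_zero, Real.exp_zero, one_mul]
          ring
      _ ≤ M * (η * (min t (1 / rlo) + P)) + L * P * M + K * (1 / rlo) := by
          rw [hesum]
          exact add_le_add (add_le_add hSmin le_rfl) (mul_le_mul_of_nonneg_left heint hK0)
      _ = M * (η * (min t (1 / rlo) + P) + L * P * (1 + (2 * Gn + L) / rlo)) + ρ₀ * (L * P / rlo) := by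
          rw [hK]; field_simp; ring
  calc ‖-(∫ s in (0 : ℝ)..t, f s) + ∫ s in (0 : ℝ)..t, exp (-((t - s) • G)) (ρ s)‖
      ≤ ‖∫ s in (0 : ℝ)..t, f s‖ + ‖∫ s in (0 : ℝ)..t, exp (-((t - s) • G)) (ρ s)‖ :=
        (norm_add_le _ _).trans (by rw [norm_neg])
    _ ≤ (M * (η * (min t (1 / rlo) + P) + L * P * (1 + (2 * Gn + L) / rlo)) + ρ₀ * (L * P / rlo)) + ρ₀ * min t (1 / rlo) :=
        add_le_add hmainI hforce
    _ = M * (η * (min t (1 / rlo) + P) + L * P * (1 + (2 * Gn + L) / rlo)) + ρ₀ * (min t (1 / rlo) + L * P / rlo) := by ring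

end Literature.Analysis.ODE.PeriodicAveraging

end
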